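import Literature.Computability.Cryptography.Pseudorandomness
import Literature.Computability.Cryptography.OneWayFunctionsProofs
import HarnessLib

/-!
# Crypto foundations: pseudorandomness — non-uniform versus uniform indistinguishability (proof of S20b)

Second sibling proof file of `Pseudorandomness.lean` (next to `PseudorandomnessProofs.lean`; D-0014: named facts `def X : Prop` are
discharged as `theorem X_holds : X`). It discharges

* `IsCompIndistinguishableNonuniform.isCompIndistinguishable_holds` (**crypto-foundations.S20**,
  second half): indistinguishability against non-uniform polynomial-time distinguishers —
  rendered in the tree as PPT distinguishers with polynomial-length advice (Goldreich 2001,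
  Def. 3.2.3 with §1.3.3) — implies indistinguishability against (uniform) PPT distinguishers
  (Def. 3.2.2). Goldreich, *Foundations of Cryptography I*, remark following Def. 3.2.3
  (§3.2.2, "Indistinguishability by Circuits"): the non-uniform notion is at least as strong,
  a probabilistic polynomial-time distinguisher being a special case of a (probabilistic)
  polynomial-size circuit family (§1.3.3, "our meta-theorem": whatever a uniform machine does,
  a non-uniform one does with the same resources).

## The proof (tree toolkit only; no machine is programmed)

Exactly as for inverters in `OneWayFunctionsProofs.lean` (`IsOneWayNonuniform.isOneWay_holds`,
Goldreich Prop. 2.2.7): a uniform PPT distinguisher `D` is the special case of the **empty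
advice** `a n = ε`. The advised distinguisher receives `⟨a n, w⟩ = boolPair (a n) w` with
`w = ⟨1ⁿ, sample⟩` the input `D` expects, so the *payload distinguisher*
`(z; r) ↦ D((boolUnpair z).2; r)` with coin budget `m ↦ coinLen_D (m − 2)` — PPT by
`IsPPT.dropAdvice` (`OneWayFunctionsProofs.lean`: `mapFstFn π₂` is polynomial time, and
`ℕ`-polynomials are monotone) — has on `⟨ε, w⟩ = 0 1 w` literally the output distribution of `D`
on `w` (same run, same number of coins: `|0 1 w| − 2 = |w|`), whence
`distAdvantageAdv D' ε X Y = distAdvantage D X Y` definitionally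
(`distAdvantageAdv_dropAdvice_nil`) and the discharge.

## References

* O. Goldreich, *Foundations of Cryptography I: Basic Tools*, CUP 2001 (2004 printing): §3.2.2,
  Def. 3.2.2, Def. 3.2.3 and the remark following it; §1.3.3 (non-uniform polynomial time as
  advice; the "meta-theorem"); §2.2.5, Prop. 2.2.7 (the same argument for inverters).
* S. Arora, B. Barak, *Computational Complexity: A Modern Approach*, CUP 2009, §0.1 (pairing),
  Thm. 2.8 (proof: composition), Def. 6.5 (advice).
-/

namespace Literature.Computability.Cryptography

open Filter Asymptotics _root_.Computability Complexity

/-- **Same acceptance law with empty advice**: on the advised input `⟨ε, ⟨1ⁿ, s⟩⟩ = 0 1 ⟨1ⁿ, s⟩`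
the payload distinguisher `(z; r) ↦ D((boolUnpair z).2; r)` (coin budget `m ↦ coinLen_D (m − 2)`)
runs `D` on `⟨1ⁿ, s⟩` with `coinLen_D |⟨1ⁿ, s⟩|` coins, so its advised acceptance distribution is
the acceptance distribution of `D` — definitionally. [Goldreich 2001, Def. 3.2.3 / §1.3.3]
[cite: Goldreich2001, Def. 3.2.3 and the remark following it] -/
theorem acceptPMFAdv_dropAdvice_nil (D : RandAlg (List Bool) Bool) (n : ℕ) (X : PMF (List Bool)) :
    acceptPMFAdv ⟨fun z r => D.run (boolUnpair z).2 r, fun m => D.coinLen (m - 2)⟩ (fun _ => [])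
      n X = acceptPMF D n X := rfl

/-- **Same advantage with empty advice**: `distAdvantageAdv D' ε X Y n = distAdvantage D X Y n`
for the payload distinguisher `D'` of `D`. [Goldreich 2001, Def. 3.2.2, Def. 3.2.3]
[cite: Goldreich2001, Def. 3.2.3 and the remark following it] -/
theorem distAdvantageAdv_dropAdvice_nil (D : RandAlg (List Bool) Bool) (X Y : Ensemble (List Bool))
    (n : ℕ) :
    distAdvantageAdv ⟨fun z r => D.run (boolUnpair z).2 r, fun m => D.coinLen (m - 2)⟩ (fun _ => [])
      X Y n = distAdvantage D X Y n := rfl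

/-- **Discharge of `IsCompIndistinguishableNonuniform.isCompIndistinguishable`**
(crypto-foundations.S20: indistinguishability by polynomial-size circuits — PPT with
polynomial-length advice — implies indistinguishability by probabilistic polynomial-time
distinguishers; Goldreich 2001, remark following Def. 3.2.3): given a PPT distinguisher `D`,
apply the non-uniform hypothesis to the PPT payload distinguisher (`IsPPT.dropAdvice`) with the
empty advice (`isPolyLength_nil`); its advised advantage is `distAdvantage D X Y`
(`distAdvantageAdv_dropAdvice_nil`), which is therefore negligible.
[cite: Goldreich2001, Def. 3.2.3 and the remark following it (§3.2.2)] -/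
theorem IsCompIndistinguishableNonuniform.isCompIndistinguishable_holds :
    IsCompIndistinguishableNonuniform.isCompIndistinguishable := by
  intro X Y h D hD
  have key := h _ hD.dropAdvice (fun _ => []) isPolyLength_nil
  have hfun : distAdvantageAdv ⟨fun z r => D.run (boolUnpair z).2 r, fun m => D.coinLen (m - 2)⟩
      (fun _ => []) X Y = distAdvantage D X Y :=
    funext fun n => distAdvantageAdv_dropAdvice_nil D X Y n
  rwa [hfun] at key

/-- Corollary in implication form: non-uniform computational indistinguishability implies
computational indistinguishability. [cite: Goldreich2001, Def. 3.2.3 and the remark following it] -/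
theorem IsCompIndistinguishableNonuniform.isCompIndistinguishable' {X Y : Ensemble (List Bool)}
    (h : IsCompIndistinguishableNonuniform X Y) : IsCompIndistinguishable X Y :=
  IsCompIndistinguishableNonuniform.isCompIndistinguishable_holds h

end Literature.Computability.Cryptography
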